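import Literature.MathematicalPhysics.QuantumLattice.HubbardOpenBoxEDUpperCertificateSplit
import HarnessLib

/-!
# Upper certificates: a cheaper hop-sign evaluation for the kernel checker

Topic `MathematicalPhysics/QuantumLattice`, family `hubbard`. In `hopApply` (`HubbardOpenBoxEDUpperCertificate`)
the Jordan–Wigner sign is `(-1) ^ (bitCount u p + bitCount u q)`, which the kernel evaluates as an iterated
integer power (one multiplication per unit of the exponent). `hopApplyFast` computes the same value with a
single parity test (`hopApplyFast_eq`); `openBoxHopApplyFast`, `UpperCert.SHop₄` are the corresponding sums
(`SHop₄_eq : SHop₄ = SHop₃`) and **`UpperCert.sound₄`** is `sound₃` restated with them — certificate files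
evaluate `SHop₄` blocks instead of `SHop₃` blocks. Nothing numerical; everything proved.

## References

* A. Neumaier, Acta Numerica 13 (2004), §11. [cite: Neumaier2004CompleteSearch, §11]
* H. Q. Lin, J. E. Gubernatis, Comput. Phys. 7 (1993) 400, §II (fermion sign = parity of the number of
  set bits between the two orbitals). [cite: LinGubernatis1993, §II]
* D. Ruelle, *Statistical Mechanics: Rigorous Results* (1969), §3.3. [cite: Ruelle1969, §3.3]
-/

namespace Literature.MathematicalPhysics.QuantumLattice

namespace OccupationCode

open Finset

/-- **Hopping word application with a parity test for the sign** (same value as `hopApply`).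
[cite: LinGubernatis1993, §II] -/
def hopApplyFast (p q m : ℕ) (f : ℕ → ℤ) : ℤ :=
  if m.testBit p = true ∧ (m - 2 ^ p).testBit q = false then
    (if (bitCount (m - 2 ^ p) p + bitCount (m - 2 ^ p) q) % 2 = 0 then f (m - 2 ^ p + 2 ^ q)
      else -f (m - 2 ^ p + 2 ^ q)) else 0

/-- `hopApplyFast = hopApply`. [cite: LinGubernatis1993, §II] -/
theorem hopApplyFast_eq (p q m : ℕ) (f : ℕ → ℤ) : hopApplyFast p q m f = hopApply p q m f := by
  unfold hopApplyFast hopApply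
  split_ifs with h hpar
  · rcases Nat.even_or_odd (bitCount (m - 2 ^ p) p + bitCount (m - 2 ^ p) q) with he | ho
    · rw [he.neg_one_pow, one_mul]
    · exfalso; rw [Nat.odd_iff] at ho; omega
  · rcases Nat.even_or_odd (bitCount (m - 2 ^ p) p + bitCount (m - 2 ^ p) q) with he | ho
    · exfalso; rw [Nat.even_iff] at he; exact hpar he
    · rw [ho.neg_one_pow, neg_one_mul]
  · rfl

/-- The fast form of `openBoxHopApply`. [cite: LinGubernatis1993, §II] -/
def openBoxHopApplyFast (adj : ℕ → ℕ → Bool) (N m : ℕ) (f : ℕ → ℤ) : ℤ :=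
  sumNat (fun P => sumNat (fun Q => if adj P Q then
    sumNat (fun σ => hopApplyFast (2 * P + σ) (2 * Q + σ) m f) 2 else 0) N) N

/-- `openBoxHopApplyFast = openBoxHopApply`. [cite: LinGubernatis1993, §II] -/
theorem openBoxHopApplyFast_eq (adj : ℕ → ℕ → Bool) (N m : ℕ) (f : ℕ → ℤ) :
    openBoxHopApplyFast adj N m f = openBoxHopApply adj N m f := by
  unfold openBoxHopApplyFast openBoxHopApply
  simp only [hopApplyFast_eq]

namespace UpperCert

variable (C : UpperCert)

/-- Split form of `SHop` with the fast hop evaluation. [cite: Neumaier2004CompleteSearch, §11] -/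
def SHop₄ (adj : ℕ → ℕ → Bool) (a b B L : ℕ) : ℤ :=
  sumNest (fun m => if C.fAt m = 0 then 0 else C.fAt m * openBoxHopApplyFast adj (a * b) m C.fAt) B L 0

/-- `SHop₄ = SHop₃`. [cite: Neumaier2004CompleteSearch, §11] -/
theorem SHop₄_eq (adj : ℕ → ℕ → Bool) (a b B L : ℕ) : C.SHop₄ adj a b B L = C.SHop₃ adj a b B L := by
  unfold SHop₄ SHop₃
  simp only [openBoxHopApplyFast_eq]

/-- **SOUNDNESS with the fast blocks**: as `sound₃`, with `SHop₄` in place of `SHop₃`. [cite: Ruelle1969, §3.3] -/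
theorem sound₄ {a b N B L : ℕ} {EK EP EM ED : ℚ} (hBL : B ^ L = 4 ^ (a * b))
    (hsupp : C.supp₃ a b N B L = true) (hNN : 0 < C.NN₃ B L)
    (hK : (-(C.SHop₄ (nnAdjCode b) a b B L) : ℚ) ≤ EK * C.NN₃ B L)
    (hP : (-(C.SHop₄ (diagAdjCode b) a b B L) : ℚ) ≤ EP * C.NN₃ B L)
    (hM : ((C.SHop₄ (diagAdjCode b) a b B L) : ℚ) ≤ EM * C.NN₃ B L)
    (hD : ((C.SD₃ a b B L) : ℚ) ≤ ED * C.NN₃ B L)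
    (ha : 1 ≤ a) (hb : 1 ≤ b) (hN : N < 2 * (a * b)) (t' : ℝ) {U : ℝ} (hU : 0 ≤ U) :
    ThermodynamicLimit.energyDensityTT' 1 t' U ((N : ℝ) / ((a : ℝ) * (b : ℝ))) ≤
      ((EK : ℝ) + max (t' * EP) (-t' * EM) + U * ED) / ((a : ℝ) * (b : ℝ)) := by
  rw [SHop₄_eq] at hK hP hM
  exact C.sound₃ hBL hsupp hNN hK hP hM hD ha hb hN t' hU

end UpperCert

end OccupationCode

end Literature.MathematicalPhysics.QuantumLattice
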